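import Literature.Probability.LatticeModels.FieldCurrentsClusters
import HarnessLib

/-!
# The cluster-pair weight `R` of Aizenman–Fernández's second-order term: conditioning inside a cluster and Lemma 5.4

Topic `Probability/LatticeModels`, namespace `Literature.Probability.LatticeModels`. Layer of the
proof of the Aizenman–Fernández differential inequalities (J. Stat. Phys. 44 (1986) 393–454) in the
`θ`-systems of `FieldCurrentsTheta` / `FieldCurrentsClusters`.

* Part A. **Lemma 3.3 with an event inside the retained region**: the factorisation of a pair sum
  on `{𝒮_b = S}` (`currentPairSum_clusterCompl_eq`) when the summand carries an additional factor
  depending only on the currents inside `S`; the inside factor is a pair sum of the depleted system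
  `cplOff θ (ℰ⁺ ∖ ℰ_S)` (`currentPairSum_clusterCompl_eq_inner`, `innerPairSum_eq_currentPairSum_cplOff`).
* Part B. **Lemma 5.4, eq. (5.13), upper bound**, for every `θ ≥ 0` (the printed lemma is the case
  `h = 0`; the proof — eq. (5.14) — is verbatim for any nonnegative couplings):
  `Z⁻² ∑_{∂n₁ = {x,u}, ∂n₂ = {u,a}} w w 𝟙[x ↔ k] ≤ ⟨σ_uσ_a⟩⟨σ_uσ_k⟩⟨σ_xσ_k⟩ + ⟨σ_xσ_u⟩⟨σ_uσ_k⟩⟨σ_aσ_k⟩`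
  (`pairSum_two_pairs_conn_le`).
* Part C. **The cluster-pair weight** `R(a,x;u,k) = ∑_{S ∋ g, S ∌ u,k} π_{a,x}(S)` (the weight that
  the cluster of `a` contains `u` and `k`, (5.45)) and its bound
  `R(a,x;u,k) ≤ ⟨σ_uσ_k⟩_{h=0} [V(a,u;k,x) + V(a,k;u,x)]`,
  `V(a,u;k,x) = E{⟨σ_aσ_u⟩_{C(h)^c} ⟨σ_xσ_k⟩_{C(h)^c}}` (`sum_clusterWeight_notMem_notMem_le`): condition
  on the cluster of the ghost (Part A), switch `{a,u}` inside, apply Lemma 5.4 inside (Part B) and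
  `⟨σ_uσ_k⟩_{C(h)^c} ≤ ⟨σ_uσ_k⟩_{h=0}`. This is the corrected form of (5.49) (whose printed right
  side, with `T(0,u,x)`, is what one gets only after summation); it is what enters the `p²C₂` bound
  (5.50)–(5.51).

Everything is proved; there are no named facts.

## References

* M. Aizenman, R. Fernández, J. Stat. Phys. 44 (1986) 393–454: §3.3 (Lemma 3.3), §5.1 (Lemma 5.4,
  eqs. (5.13)–(5.14)), §5.3 (eqs. (5.45), (5.49)–(5.51)) [AizenmanFernandezJSP1986]
  (held: `paper:url-b8cebc3f44bb`).
* H. Duminil-Copin, V. Tassion, Comm. Math. Phys. 343 (2016) 725–745, proof of Lemma 2.6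
  (the factorisation `nᵢ = nᵢ^S + nᵢ^{Λ∖S}`) [DuminilCopinTassionCMP2016].
-/

noncomputable section

open Finset MeasureTheory
open scoped symmDiff ENNReal

namespace Literature.Probability.LatticeModels

variable {V : Type*} [DecidableEq V]

section SecondOrder

variable {G : SimpleGraph V} [G.LocallyFinite] {Λ : Finset V}

local notation "Gg" => ghostGraph G Λ
local notation "Λg" => Finset.insertNone Λ
local notation "Eg" => edgesIn (ghostGraph G Λ) (Finset.insertNone Λ)
local notation "Zg[" θ ", " X "]" =>
  gcurrentZ (ghostGraph G Λ) (Finset.insertNone Λ) θ (edgesIn (ghostGraph G Λ) (Finset.insertNone Λ)) X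
local notation "ZIn[" θ ", " S ", " X "]" =>
  gcurrentZ (ghostGraph G Λ) (Finset.insertNone Λ) θ (edgesIn (ghostGraph G Λ) S) X
local notation "Conn[" m ", " u ", " v "]" =>
  CConn (ghostGraph G Λ) (Finset.insertNone Λ) m (edgesIn (ghostGraph G Λ) (Finset.insertNone Λ)) u v
local notation "∂g" => csources (ghostGraph G Λ) (Finset.insertNone Λ)
local notation "𝒮[" m ", " b "]" => clusterCompl (ghostGraph G Λ) (Finset.insertNone Λ) m b

/-! ## Part A. Lemma 3.3 with an event inside the retained region -/

variable (G Λ) in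
/-- The pair sum over currents supported inside `S`, with prescribed sources and a weight `F`. [cite: AizenmanFernandezJSP1986, §3.3, Lemma 3.3 (the sums "inside … the cluster")] -/
def innerPairSum (θ : Sym2 (Option V) → ℝ) (S : Finset (Option V)) (X₁ Y₁ : Finset (Option V))
    (F : (Eg → ℕ) → ℝ≥0∞) : ℝ≥0∞ :=
  ∑' a : (Eg → ℕ) × (Eg → ℕ),
    ind (CSupp Gg Λg (edgesIn Gg S) a.1 ∧ CSupp Gg Λg (edgesIn Gg S) a.2) *
      (ind (∂g a.1 = X₁) * ind (∂g a.2 = Y₁) * (gweight Gg Λg θ a.1 * gweight Gg Λg θ a.2 * F (a.1 + a.2)))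

/-- **Lemma 3.3 with an inside event**: for `S ⊆ Λ ∪ {g}`, `b ∉ S`, source sets `X, Y` and a weight
`F` applied to the restriction of `n₁ + n₂` to the edges inside `S`,
`∑_{∂n₁ = X, ∂n₂ = Y} w w 𝟙[𝒮_b = S] F((n₁+n₂)^S) = (inner pair sum of `F` with sources `X ∩ S, Y ∩ S`) · Ψ_S(X ∖ S, Y ∖ S)`
(the proof of `currentPairSum_clusterCompl_eq` verbatim, the inside factor now carrying `F`). [cite: AizenmanFernandezJSP1986, §3.3, Lemma 3.3, eq. (3.11)] -/
theorem currentPairSum_clusterCompl_eq_inner (θ : Sym2 (Option V) → ℝ) {S : Finset (Option V)} (hS : S ⊆ Λg)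
    {b : Option V} (hb : b ∈ Λg \ S) (X Y : Finset (Option V)) (F : (Eg → ℕ) → ℝ≥0∞) :
    currentPairSum G Λ θ X Y (fun m => ind (𝒮[m, b] = S) * F (crestr Gg Λg (edgesIn Gg S) m)) =
      innerPairSum G Λ θ S (X.filter (· ∈ S)) (Y.filter (· ∈ S)) F *
        outerSum G Λ θ S b (X.filter (· ∉ S)) (Y.filter (· ∉ S)) := by
  set E₁ := edgesIn Gg S with hE₁
  set E₂ := edgesIn Gg (Λg \ S) with hE₂
  have hdisj : Disjoint E₁ E₂ := disjoint_edgesIn_sdiff S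
  set G₁ : (Eg → ℕ) → (Eg → ℕ) → ℝ≥0∞ := fun a₁ a₂ =>
    ind (∂g a₁ = X.filter (· ∈ S)) * ind (∂g a₂ = Y.filter (· ∈ S)) *
      (gweight Gg Λg θ a₁ * gweight Gg Λg θ a₂ * F (a₁ + a₂)) with hG₁
  set G₂ : (Eg → ℕ) → (Eg → ℕ) → ℝ≥0∞ := fun b₁ b₂ =>
    ind (∂g b₁ = X.filter (· ∉ S)) * ind (∂g b₂ = Y.filter (· ∉ S)) *
      (gweight Gg Λg θ b₁ * gweight Gg Λg θ b₂ * ind (∀ v ∈ Λg \ S, CConn Gg Λg (b₁ + b₂) E₂ b v))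
    with hG₂
  have hpt : ∀ p : (Eg → ℕ) × (Eg → ℕ),
      ind (∂g p.1 = X ∧ CSupp Gg Λg Eg p.1) * ind (∂g p.2 = Y ∧ CSupp Gg Λg Eg p.2) *
          (gweight Gg Λg θ p.1 * gweight Gg Λg θ p.2 *
            (ind (𝒮[p.1 + p.2, b] = S) * F (crestr Gg Λg E₁ (p.1 + p.2)))) =
        ind (CSupp Gg Λg (E₁ ∪ E₂) p.1) * ind (CSupp Gg Λg (E₁ ∪ E₂) p.2) *
          (G₁ (crestr Gg Λg E₁ p.1) (crestr Gg Λg E₁ p.2) * G₂ (crestr Gg Λg E₂ p.1) (crestr Gg Λg E₂ p.2)) := by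
    intro p
    by_cases hcut : CSupp Gg Λg (E₁ ∪ E₂) p.1 ∧ CSupp Gg Λg (E₁ ∪ E₂) p.2
    · obtain ⟨hc1, hc2⟩ := hcut
      have hc12 : CSupp Gg Λg (E₁ ∪ E₂) (p.1 + p.2) := (csupp_add_iff p.1 p.2).2 ⟨hc1, hc2⟩
      rw [ind_of_true hc1, ind_of_true hc2, one_mul, one_mul]
      have hsrc : ∀ (n : Eg → ℕ) (Z : Finset (Option V)), CSupp Gg Λg (E₁ ∪ E₂) n →
          (ind (∂g n = Z ∧ CSupp Gg Λg Eg n) =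
            ind (∂g (crestr Gg Λg E₁ n) = Z.filter (· ∈ S)) * ind (∂g (crestr Gg Λg E₂ n) = Z.filter (· ∉ S))) := by
        intro n Z hn
        rw [← ind_and]
        refine ind_congr ?_
        rw [csources_crestr_inner hn, csources_crestr_outer hn]
        constructor
        · rintro ⟨h, -⟩
          rw [h]
          exact ⟨rfl, rfl⟩
        · rintro ⟨h1, h2⟩
          refine ⟨?_, csupp_edgesIn n⟩
          rw [← filter_union_filter_not_eq (· ∈ S) (∂g n), ← filter_union_filter_not_eq (· ∈ S) Z, h1, h2]
      have hw1 := gweight_eq_mul_of_csupp_union θ hdisj hc1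
      have hw2 := gweight_eq_mul_of_csupp_union θ hdisj hc2
      have hev : ind (𝒮[p.1 + p.2, b] = S) =
          ind (∀ v ∈ Λg \ S, CConn Gg Λg (crestr Gg Λg E₂ p.1 + crestr Gg Λg E₂ p.2) E₂ b v) := by
        refine ind_congr ?_
        rw [clusterCompl_eq_iff hS hb, ← crestr_add]
        simp only [cconn_crestr_iff]
        exact ⟨fun h => h.2, fun h => ⟨hc12, h⟩⟩
      rw [hsrc p.1 X hc1, hsrc p.2 Y hc2, hw1, hw2, hev, crestr_add]
      simp only [hG₁, hG₂]
      ring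
    · have hzero : ind (𝒮[p.1 + p.2, b] = S) = 0 ∨
          (CSupp Gg Λg (E₁ ∪ E₂) p.1 ∧ CSupp Gg Λg (E₁ ∪ E₂) p.2) := by
        by_cases hS' : 𝒮[p.1 + p.2, b] = S
        · exact Or.inr ((csupp_add_iff p.1 p.2).1 (csupp_cut_of_clusterCompl_eq hS'))
        · exact Or.inl (ind_of_false hS')
      rcases hzero with h0 | h
      · rw [h0, zero_mul, mul_zero, mul_zero]
        rcases not_and_or.1 hcut with h1 | h2
        · rw [ind_of_false h1, zero_mul, zero_mul]
        · rw [ind_of_false h2, mul_zero, zero_mul]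
      · exact absurd h hcut
  unfold currentPairSum
  simp_rw [hpt]
  rw [tsum_pair_eq_mul_of_csupp_union Gg Λg hdisj G₁ G₂]
  rfl

/-- **The inside pair sum is a pair sum of the depleted system** `cplOff θ (ℰ⁺ ∖ ℰ_S)`
(currents charging an edge outside `S` weigh nothing there). [cite: AizenmanFernandezJSP1986, §3.3, Lemma 3.2, eq. (3.10)] -/
theorem innerPairSum_eq_currentPairSum_cplOff (θ : Sym2 (Option V) → ℝ) (S : Finset (Option V)) (X₁ Y₁ : Finset (Option V))
    (F : (Eg → ℕ) → ℝ≥0∞) :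
    innerPairSum G Λ θ S X₁ Y₁ F = currentPairSum G Λ (cplOff θ (Eg \ edgesIn Gg S)) X₁ Y₁ F := by
  unfold innerPairSum currentPairSum
  refine tsum_congr fun p => ?_
  have hw : ∀ n : Eg → ℕ, CSupp Gg Λg (edgesIn Gg S) n →
      gweight Gg Λg (cplOff θ (Eg \ edgesIn Gg S)) n = gweight Gg Λg θ n := by
    intro n hn
    refine gweight_congr fun e he => ?_
    exact cplOff_of_not_mem fun h => (mem_sdiff.1 h).2 (hn e he)
  have hw0 : ∀ n : Eg → ℕ, ¬CSupp Gg Λg (edgesIn Gg S) n →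
      gweight Gg Λg (cplOff θ (Eg \ edgesIn Gg S)) n = 0 := by
    intro n hn
    obtain ⟨e, hne, he⟩ : ∃ e : Eg, n e ≠ 0 ∧ (e : Sym2 (Option V)) ∉ edgesIn Gg S := by
      by_contra hcon
      simp only [not_exists, not_and, not_not] at hcon
      exact hn fun e he => hcon e he
    exact gweight_eq_zero_of_apply_ne_zero (cplOff_of_mem (mem_sdiff.2 ⟨e.2, he⟩)) hne
  by_cases h1 : CSupp Gg Λg (edgesIn Gg S) p.1
  · by_cases h2 : CSupp Gg Λg (edgesIn Gg S) p.2
    · rw [ind_of_true ⟨h1, h2⟩, one_mul, hw p.1 h1, hw p.2 h2]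
      congr 2
      · exact ind_congr ⟨fun h => ⟨h, csupp_edgesIn p.1⟩, fun h => h.1⟩
      · exact ind_congr ⟨fun h => ⟨h, csupp_edgesIn p.2⟩, fun h => h.1⟩
    · rw [ind_of_false fun h => h2 h.2, zero_mul, hw0 p.2 h2]; simp
  · rw [ind_of_false fun h => h1 h.1, zero_mul, hw0 p.1 h1]; simp

/-- Pair sums of a depleted system only see pairs of currents supported in the retained edges:
the weight `F` may be changed off those. [folklore] -/
theorem currentPairSum_cplOff_congr (θ : Sym2 (Option V) → ℝ) (S : Finset (Option V)) (X₁ Y₁ : Finset (Option V))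
    {F F' : (Eg → ℕ) → ℝ≥0∞}
    (h : ∀ n₁ n₂ : Eg → ℕ, CSupp Gg Λg (edgesIn Gg S) n₁ → CSupp Gg Λg (edgesIn Gg S) n₂ → F (n₁ + n₂) = F' (n₁ + n₂)) :
    currentPairSum G Λ (cplOff θ (Eg \ edgesIn Gg S)) X₁ Y₁ F = currentPairSum G Λ (cplOff θ (Eg \ edgesIn Gg S)) X₁ Y₁ F' := by
  rw [← innerPairSum_eq_currentPairSum_cplOff, ← innerPairSum_eq_currentPairSum_cplOff]
  unfold innerPairSum
  refine tsum_congr fun p => ?_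
  by_cases hs : CSupp Gg Λg (edgesIn Gg S) p.1 ∧ CSupp Gg Λg (edgesIn Gg S) p.2
  · rw [h p.1 p.2 hs.1 hs.2]
  · rw [ind_of_false hs, zero_mul, zero_mul]

/-! ## Part B. Lemma 5.4, the upper bound in (5.13) -/

/-- The law of the complement of the cluster of the site `k` under the duplicated sourceless
currents: `μ_k(T) = Z⁻² ∑_{∂n₁ = ∂n₂ = ∅} w w 𝟙[𝒮_k = T]`. [cite: AizenmanFernandezJSP1986, §5.1, proof of Lemma 5.4, eq. (5.14) (the measure `E` with `C(l)`)] -/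
def siteClusterWeight (G : SimpleGraph V) [G.LocallyFinite] (Λ : Finset V) (θ : Sym2 (Option V) → ℝ) (k : V)
    (T : Finset (Option V)) : ℝ :=
  (currentPairSum G Λ θ ∅ ∅ (fun m => ind (clusterCompl (ghostGraph G Λ) (Finset.insertNone Λ) m (some k) = T))).toReal /
    (gcurrentZ (ghostGraph G Λ) (Finset.insertNone Λ) θ (edgesIn (ghostGraph G Λ) (Finset.insertNone Λ)) ∅).toReal ^ 2

/-- `μ_k ≥ 0`. [folklore] -/
theorem siteClusterWeight_nonneg (θ : Sym2 (Option V) → ℝ) (k : V) (T : Finset (Option V)) :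
    0 ≤ siteClusterWeight G Λ θ k T :=
  div_nonneg ENNReal.toReal_nonneg (pow_nonneg ENNReal.toReal_nonneg 2)

/-- `μ_k` is a probability: `∑_{T ∌ k} μ_k(T) = 1`. [folklore] -/
theorem sum_siteClusterWeight_eq_one {θ : Sym2 (Option V) → ℝ} (hθ : ∀ e, 0 ≤ θ e) (k : V) :
    ∑ T ∈ (Λg).powerset.filter (fun T => (some k : Option V) ∉ T), siteClusterWeight G Λ θ k T = 1 := by
  unfold siteClusterWeight
  rw [← sum_div, ← ENNReal.toReal_sum (fun T _ => currentPairSum_ne_top hθ _ _ fun _ => ind_le_one _),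
    ← currentPairSum_ind_mem_eq_sum]
  have h1 : currentPairSum G Λ θ ∅ ∅ (fun m => ind (𝒮[m, some k] ∈ (Λg).powerset.filter (fun T => (some k : Option V) ∉ T))) =
      currentPairSum G Λ θ ∅ ∅ (fun _ => 1) := by
    refine currentPairSum_congr fun n₁ n₂ _ _ => ind_of_true ?_
    exact mem_filter.2 ⟨mem_powerset.2 (clusterCompl_subset _ _), not_mem_clusterCompl_self _ _⟩
  rw [h1, currentPairSum_one, ENNReal.toReal_mul, ← pow_two]
  exact div_self (pow_ne_zero 2 (toReal_gcurrentZ_ghost_empty_pos subset_rfl hθ subset_rfl).ne')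

/-- On `𝒮_k = T ⊇ A*, B*` the pair sum with sources `A*, B*` decouples:
`Z⁻² ∑_{∂n₁ = A*, ∂n₂ = B*} w w 𝟙[𝒮_k = T] = ⟨σ_A⟩_T ⟨σ_B⟩_T μ_k(T)`. [cite: AizenmanFernandezJSP1986, §5.1, Lemma 5.1 for the cluster of a site (the analogue of (5.1) with `C(l)`)] -/
theorem pairSum_siteCluster_toReal_eq {θ : Sym2 (Option V) → ℝ} (hθ : ∀ e, 0 ≤ θ e) {k : V} (hk : k ∈ Λ)
    {T : Finset (Option V)} (hT : T ⊆ Λg) (hkT : (some k : Option V) ∉ T)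
    {A B : Finset V} (hA : A ⊆ Λ) (hB : B ⊆ Λ) (hAT : starSet A ⊆ T) (hBT : starSet B ⊆ T) :
    (currentPairSum G Λ θ (starSet A) (starSet B) (fun m => ind (𝒮[m, some k] = T))).toReal / (Zg[θ, ∅]).toReal ^ 2 =
      corrIn G Λ θ T A * corrIn G Λ θ T B * siteClusterWeight G Λ θ k T := by
  have hb : (some k : Option V) ∈ Λg \ T := mem_sdiff.2 ⟨Finset.some_mem_insertNone.2 hk, hkT⟩
  have hZT : 0 < (ZIn[θ, T, ∅]).toReal := toReal_gcurrentZ_in_pos hθ hT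
  have hZpos : 0 < (Zg[θ, ∅]).toReal := toReal_gcurrentZ_ghost_empty_pos subset_rfl hθ subset_rfl
  have h1 := currentPairSum_clusterCompl_strip (G := G) θ hT hb (starSet A) (starSet B)
  rw [filter_true_of_mem (fun v hv => hAT hv), filter_true_of_mem (fun v hv => hBT hv),
    filter_false_of_mem (fun v hv => not_not.2 (hAT hv)), filter_false_of_mem (fun v hv => not_not.2 (hBT hv))] at h1
  have h2 := currentPairSum_clusterCompl_strip (G := G) θ hT hb ∅ ∅
  simp only [Finset.filter_empty] at h2
  rw [corrIn_eq_gcurrentZ_div hθ hT hA, corrIn_eq_gcurrentZ_div hθ hT hB, siteClusterWeight]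
  have e1 := congrArg ENNReal.toReal h1
  have e2 := congrArg ENNReal.toReal h2
  simp only [ENNReal.toReal_mul] at e1 e2
  set P := (currentPairSum G Λ θ (starSet A) (starSet B) fun m => ind (𝒮[m, some k] = T)).toReal
  set P0 := (currentPairSum G Λ θ ∅ ∅ fun m => ind (𝒮[m, some k] = T)).toReal
  set ZA := (ZIn[θ, T, starSet A]).toReal
  set ZB := (ZIn[θ, T, starSet B]).toReal
  set Z0 := (ZIn[θ, T, ∅]).toReal
  rw [div_mul_div_comm, div_mul_div_comm, div_eq_div_iff (pow_pos hZpos 2).ne' (by positivity)]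
  linear_combination e1 * (Zg[θ, ∅]).toReal ^ 2

/-- **Aizenman–Fernández 1986, Lemma 5.4, the upper bound of (5.13)** (printed at `h = 0`; the proof,
eq. (5.14), holds for any couplings `θ ≥ 0`): for `x ≠ u`, `u ≠ a` and any `k` in `Λ`,
`Z⁻² ∑_{∂n₁ = {x,u}, ∂n₂ = {u,a}} w(n₁)w(n₂) 𝟙[n₁+n₂ : x ↔ k] ≤ ⟨σ_uσ_a⟩⟨σ_uσ_k⟩⟨σ_xσ_k⟩ + ⟨σ_xσ_u⟩⟨σ_uσ_k⟩⟨σ_aσ_k⟩`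
("the required connections … performed in the minimal way": either the `n₁`-path or the
`n₂`-path visits `k`). Proof as printed: write `𝟙[x ↔ k] = 1 - 𝟙[x ↮ k]`, condition on the cluster
of `k`, add and subtract, Griffiths II, and the switching lemma. [cite: AizenmanFernandezJSP1986, §5.1, Lemma 5.4, eqs. (5.13)–(5.14)] -/
theorem pairSum_two_pairs_conn_le {θ : Sym2 (Option V) → ℝ} (hθ : ∀ e, 0 ≤ θ e) {x u a k : V}
    (hx : x ∈ Λ) (hu : u ∈ Λ) (ha : a ∈ Λ) (hk : k ∈ Λ) (hxu : x ≠ u) (hua : u ≠ a) :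
    (currentPairSum G Λ θ (starSet ({x} ∆ {u})) (starSet ({u} ∆ {a}))
        (fun m => ind Conn[m, some x, some k])).toReal / (Zg[θ, ∅]).toReal ^ 2 ≤
      thetaCorr G Λ θ ({u} ∆ {a}) * thetaCorr G Λ θ ({u} ∆ {k}) * thetaCorr G Λ θ ({x} ∆ {k}) +
        thetaCorr G Λ θ ({x} ∆ {u}) * thetaCorr G Λ θ ({u} ∆ {k}) * thetaCorr G Λ θ ({a} ∆ {k}) := by
  classical
  set X := starSet ({x} ∆ {u}) with hX
  set Y := starSet ({u} ∆ {a}) with hY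
  set 𝒯 := (Λg).powerset.filter (fun T => (some k : Option V) ∉ T) with h𝒯
  set μ : Finset (Option V) → ℝ := fun T => siteClusterWeight G Λ θ k T with hμ
  set cX : Finset (Option V) → ℝ := fun T => corrIn G Λ θ T ({x} ∆ {u}) with hcX
  set cY : Finset (Option V) → ℝ := fun T => corrIn G Λ θ T ({u} ∆ {a}) with hcY
  have hZpos : 0 < (Zg[θ, ∅]).toReal := toReal_gcurrentZ_ghost_empty_pos subset_rfl hθ subset_rfl
  have hxu' : ({x} ∆ {u} : Finset V) ⊆ Λ := symmDiff_le_sup.trans (sup_le (singleton_subset_iff.2 hx) (singleton_subset_iff.2 hu))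
  have hua' : ({u} ∆ {a} : Finset V) ⊆ Λ := symmDiff_le_sup.trans (sup_le (singleton_subset_iff.2 hu) (singleton_subset_iff.2 ha))
  have hXdef : X = ({some x} ∆ {some u} : Finset (Option V)) := by rw [hX, starSet_pair]
  have hYdef : Y = ({some u} ∆ {some a} : Finset (Option V)) := by rw [hY, starSet_pair]
  -- source connectivity
  have hconnXu : ∀ {n m : Eg → ℕ}, n ≤ m → ∂g n = X → Conn[m, some x, some u] := by
    intro n m hle hsrc
    rw [hXdef] at hsrc
    exact (cconn_of_csources_eq (fun h => hxu (Option.some_injective _ h)) hsrc).mono fun e => hle e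
  have hconnYa : ∀ {n m : Eg → ℕ}, n ≤ m → ∂g n = Y → Conn[m, some u, some a] := by
    intro n m hle hsrc
    rw [hYdef] at hsrc
    exact (cconn_of_csources_eq (fun h => hua (Option.some_injective _ h)) hsrc).mono fun e => hle e
  -- basic facts on the cluster law
  have hμ0 : ∀ T, 0 ≤ μ T := fun T => siteClusterWeight_nonneg θ k T
  have hμ1 : ∑ T ∈ 𝒯, μ T = 1 := sum_siteClusterWeight_eq_one hθ k
  have hcX0 : ∀ T, 0 ≤ cX T := fun T => corrIn_nonneg hθ T hxu'
  have hcY0 : ∀ T, 0 ≤ cY T := fun T => corrIn_nonneg hθ T hua'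
  have hcXle : ∀ T, cX T ≤ thetaCorr G Λ θ ({x} ∆ {u}) := fun T => corrIn_le_thetaCorr hθ T hxu'
  have hcYle : ∀ T, cY T ≤ thetaCorr G Λ θ ({u} ∆ {a}) := fun T => corrIn_le_thetaCorr hθ T hua'
  -- vanishing of the depleted pair functions when a source leaves `T`
  have hcXz : ∀ T ∈ 𝒯, ¬((some x : Option V) ∈ T ∧ (some u : Option V) ∈ T) → cX T = 0 := by
    intro T hT hnot
    have hTΛ : T ⊆ Λg := mem_powerset.1 (mem_filter.1 hT).1
    rcases not_and_or.1 hnot with h | h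
    · simp only [hcX]; rw [symmDiff_comm]; exact corrIn_pair_eq_zero hθ hTΛ hu hx (Ne.symm hxu) h
    · exact corrIn_pair_eq_zero hθ hTΛ hx hu hxu h
  have hcYz : ∀ T ∈ 𝒯, ¬((some u : Option V) ∈ T ∧ (some a : Option V) ∈ T) → cY T = 0 := by
    intro T hT hnot
    have hTΛ : T ⊆ Λg := mem_powerset.1 (mem_filter.1 hT).1
    rcases not_and_or.1 hnot with h | h
    · simp only [hcY]; rw [symmDiff_comm]; exact corrIn_pair_eq_zero hθ hTΛ ha hu (Ne.symm hua) h
    · exact corrIn_pair_eq_zero hθ hTΛ hu ha hua h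
  -- subsets of `T`
  have hXsub : ∀ {T : Finset (Option V)}, (some x : Option V) ∈ T → (some u : Option V) ∈ T → X ⊆ T := by
    intro T hxT huT v hv
    rw [hXdef, mem_symmDiff, mem_singleton, mem_singleton] at hv
    rcases hv with ⟨rfl, -⟩ | ⟨rfl, -⟩
    · exact hxT
    · exact huT
  have hYsub : ∀ {T : Finset (Option V)}, (some u : Option V) ∈ T → (some a : Option V) ∈ T → Y ⊆ T := by
    intro T huT haT v hv
    rw [hYdef, mem_symmDiff, mem_singleton, mem_singleton] at hv
    rcases hv with ⟨rfl, -⟩ | ⟨rfl, -⟩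
    · exact huT
    · exact haT
  -- (i) `Z⁻² ∑_{X ⊗ Y} 𝟙[x ↮ k] = ∑_T μ cX cY`
  have hi : (currentPairSum G Λ θ X Y (fun m => ind (¬Conn[m, some x, some k]))).toReal / (Zg[θ, ∅]).toReal ^ 2 =
      ∑ T ∈ 𝒯, μ T * (cX T * cY T) := by
    set 𝒯' := 𝒯.filter (fun T => (some x : Option V) ∈ T ∧ (some u : Option V) ∈ T ∧ (some a : Option V) ∈ T) with h𝒯'
    have hev : currentPairSum G Λ θ X Y (fun m => ind (¬Conn[m, some x, some k])) =
        currentPairSum G Λ θ X Y (fun m => ind (𝒮[m, some k] ∈ 𝒯')) := by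
      refine currentPairSum_congr fun n₁ n₂ h1 h2 => ind_congr ?_
      have hxu'' := hconnXu (n := n₁) (m := n₁ + n₂) (fun e => Nat.le_add_right _ _) h1
      have hua'' := hconnYa (n := n₂) (m := n₁ + n₂) (fun e => Nat.le_add_left _ _) h2
      rw [h𝒯', mem_filter, h𝒯, mem_filter, mem_powerset, some_mem_clusterCompl_iff hx, some_mem_clusterCompl_iff hu,
        some_mem_clusterCompl_iff ha]
      constructor
      · intro hxk
        have hkx' : ¬Conn[n₁ + n₂, some k, some x] := fun h => hxk h.symm
        refine ⟨⟨clusterCompl_subset _ _, not_mem_clusterCompl_self _ _⟩, hkx', fun h => hkx' (h.trans hxu''.symm),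
          fun h => hkx' ((h.trans hua''.symm).trans hxu''.symm)⟩
      · rintro ⟨-, hkx', -, -⟩
        exact fun h => hkx' h.symm
    rw [hev, currentPairSum_ind_mem_eq_sum, ENNReal.toReal_sum (fun T _ => currentPairSum_ne_top hθ _ _ fun _ => ind_le_one _),
      sum_div]
    have hsub𝒯 : 𝒯' ⊆ 𝒯 := filter_subset _ _
    rw [← sum_subset hsub𝒯 (fun T hT hT' => ?_)]
    · refine sum_congr rfl fun T hT => ?_
      rw [h𝒯', mem_filter] at hT
      obtain ⟨hT𝒯, hxT, huT, haT⟩ := hT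
      rw [h𝒯, mem_filter, mem_powerset] at hT𝒯
      rw [hX, hY, pairSum_siteCluster_toReal_eq hθ hk hT𝒯.1 hT𝒯.2 hxu' hua' (by rw [← hX]; exact hXsub hxT huT)
        (by rw [← hY]; exact hYsub huT haT)]
      simp only [hμ, hcX, hcY]; ring
    · -- outside `𝒯'` the product `cX cY` vanishes
      have : ¬((some x : Option V) ∈ T ∧ (some u : Option V) ∈ T) ∨ ¬((some u : Option V) ∈ T ∧ (some a : Option V) ∈ T) := by
        by_contra hcon
        rw [not_or, not_not, not_not] at hcon
        exact hT' (mem_filter.2 ⟨hT, hcon.1.1, hcon.1.2, hcon.2.2⟩)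
      rcases this with h | h
      · rw [hcXz T hT h]; ring
      · rw [hcYz T hT h]; ring
  -- (ii) `Z⁻² ∑_{X ⊗ Y} 1 = ⟨X⟩⟨Y⟩`
  have hii : (currentPairSum G Λ θ X Y (fun _ => 1)).toReal / (Zg[θ, ∅]).toReal ^ 2 =
      thetaCorr G Λ θ ({x} ∆ {u}) * thetaCorr G Λ θ ({u} ∆ {a}) := by
    rw [currentPairSum_one, ENNReal.toReal_mul, thetaCorr_eq_gcurrentZ_div hθ hxu', thetaCorr_eq_gcurrentZ_div hθ hua',
      hX, hY, div_mul_div_comm, pow_two]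
  -- (iii) `⟨X⟩ - ∑_T μ cX = ⟨σ_uσ_k⟩⟨σ_xσ_k⟩` and the same for `Y`
  have hiii : thetaCorr G Λ θ ({x} ∆ {u}) - ∑ T ∈ 𝒯, μ T * cX T =
      thetaCorr G Λ θ ({u} ∆ {k}) * thetaCorr G Λ θ ({x} ∆ {k}) := by
    rw [← pairSum_conn_toReal_eq hθ hx hu hk]
    -- `∑_T μ cX = Z⁻² ∑_{X ⊗ ∅} 𝟙[x ↮ k]`
    set 𝒯'' := 𝒯.filter (fun T => (some x : Option V) ∈ T ∧ (some u : Option V) ∈ T) with h𝒯''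
    have h1 : ∑ T ∈ 𝒯, μ T * cX T = (currentPairSum G Λ θ X ∅ (fun m => ind (¬Conn[m, some x, some k]))).toReal / (Zg[θ, ∅]).toReal ^ 2 := by
      have hev : currentPairSum G Λ θ X ∅ (fun m => ind (¬Conn[m, some x, some k])) =
          currentPairSum G Λ θ X ∅ (fun m => ind (𝒮[m, some k] ∈ 𝒯'')) := by
        refine currentPairSum_congr fun n₁ n₂ h1 _ => ind_congr ?_
        have hxu'' := hconnXu (n := n₁) (m := n₁ + n₂) (fun e => Nat.le_add_right _ _) h1
        rw [h𝒯'', mem_filter, h𝒯, mem_filter, mem_powerset, some_mem_clusterCompl_iff hx, some_mem_clusterCompl_iff hu]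
        constructor
        · intro hxk
          have hkx' : ¬Conn[n₁ + n₂, some k, some x] := fun h => hxk h.symm
          exact ⟨⟨clusterCompl_subset _ _, not_mem_clusterCompl_self _ _⟩, hkx', fun h => hkx' (h.trans hxu''.symm)⟩
        · rintro ⟨-, hkx', -⟩
          exact fun h => hkx' h.symm
      rw [hev, currentPairSum_ind_mem_eq_sum, ENNReal.toReal_sum (fun T _ => currentPairSum_ne_top hθ _ _ fun _ => ind_le_one _),
        sum_div]
      have hsub𝒯 : 𝒯'' ⊆ 𝒯 := filter_subset _ _
      rw [← sum_subset hsub𝒯 (fun T hT hT' => ?_)]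
      · refine sum_congr rfl fun T hT => ?_
        rw [h𝒯'', mem_filter] at hT
        obtain ⟨hT𝒯, hxT, huT⟩ := hT
        rw [h𝒯, mem_filter, mem_powerset] at hT𝒯
        have := pairSum_siteCluster_toReal_eq hθ hk hT𝒯.1 hT𝒯.2 hxu' (empty_subset Λ) (by rw [← hX]; exact hXsub hxT huT)
          (by rw [starSet_empty]; exact empty_subset _) (θ := θ) (G := G)
        rw [starSet_empty] at this
        rw [hX, this, show corrIn G Λ θ T ∅ = 1 from thetaCorr_empty _]
        simp only [hμ, hcX]; ring
      · have : ¬((some x : Option V) ∈ T ∧ (some u : Option V) ∈ T) := fun hcon => hT' (mem_filter.2 ⟨hT, hcon⟩)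
        rw [hcXz T hT this]; ring
    -- `⟨X⟩ = Z⁻² ∑_{X ⊗ ∅} 1`, and `1 = 𝟙[x ↔ k] + 𝟙[x ↮ k]`
    have h2 : thetaCorr G Λ θ ({x} ∆ {u}) = (currentPairSum G Λ θ X ∅ (fun _ => 1)).toReal / (Zg[θ, ∅]).toReal ^ 2 := by
      rw [currentPairSum_one, ENNReal.toReal_mul, thetaCorr_eq_gcurrentZ_div hθ hxu', hX, pow_two,
        mul_div_mul_right _ _ hZpos.ne']
    have h3 : currentPairSum G Λ θ X ∅ (fun _ => 1) = currentPairSum G Λ θ X ∅ (fun m => ind Conn[m, some x, some k]) +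
        currentPairSum G Λ θ X ∅ (fun m => ind (¬Conn[m, some x, some k])) := by
      rw [← currentPairSum_add]
      refine currentPairSum_congr fun n₁ n₂ _ _ => ?_
      by_cases h : Conn[n₁ + n₂, some x, some k]
      · rw [ind_of_true h, ind_of_false (not_not.2 h), add_zero]
      · rw [ind_of_false h, ind_of_true h, zero_add]
    rw [h1, h2, h3, ENNReal.toReal_add (currentPairSum_ne_top hθ _ _ fun _ => ind_le_one _)
      (currentPairSum_ne_top hθ _ _ fun _ => ind_le_one _), add_div, hX]
    ring
  have hiv : thetaCorr G Λ θ ({u} ∆ {a}) - ∑ T ∈ 𝒯, μ T * cY T =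
      thetaCorr G Λ θ ({a} ∆ {k}) * thetaCorr G Λ θ ({u} ∆ {k}) := by
    rw [← pairSum_conn_toReal_eq hθ hu ha hk]
    set 𝒯'' := 𝒯.filter (fun T => (some u : Option V) ∈ T ∧ (some a : Option V) ∈ T) with h𝒯''
    have h1 : ∑ T ∈ 𝒯, μ T * cY T = (currentPairSum G Λ θ Y ∅ (fun m => ind (¬Conn[m, some u, some k]))).toReal / (Zg[θ, ∅]).toReal ^ 2 := by
      have hev : currentPairSum G Λ θ Y ∅ (fun m => ind (¬Conn[m, some u, some k])) =
          currentPairSum G Λ θ Y ∅ (fun m => ind (𝒮[m, some k] ∈ 𝒯'')) := by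
        refine currentPairSum_congr fun n₁ n₂ h1 _ => ind_congr ?_
        have hua'' := hconnYa (n := n₁) (m := n₁ + n₂) (fun e => Nat.le_add_right _ _) h1
        rw [h𝒯'', mem_filter, h𝒯, mem_filter, mem_powerset, some_mem_clusterCompl_iff hu, some_mem_clusterCompl_iff ha]
        constructor
        · intro huk
          have hku' : ¬Conn[n₁ + n₂, some k, some u] := fun h => huk h.symm
          exact ⟨⟨clusterCompl_subset _ _, not_mem_clusterCompl_self _ _⟩, hku', fun h => hku' (h.trans hua''.symm)⟩
        · rintro ⟨-, hku', -⟩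
          exact fun h => hku' h.symm
      rw [hev, currentPairSum_ind_mem_eq_sum, ENNReal.toReal_sum (fun T _ => currentPairSum_ne_top hθ _ _ fun _ => ind_le_one _),
        sum_div]
      have hsub𝒯 : 𝒯'' ⊆ 𝒯 := filter_subset _ _
      rw [← sum_subset hsub𝒯 (fun T hT hT' => ?_)]
      · refine sum_congr rfl fun T hT => ?_
        rw [h𝒯'', mem_filter] at hT
        obtain ⟨hT𝒯, huT, haT⟩ := hT
        rw [h𝒯, mem_filter, mem_powerset] at hT𝒯
        have := pairSum_siteCluster_toReal_eq hθ hk hT𝒯.1 hT𝒯.2 hua' (empty_subset Λ) (by rw [← hY]; exact hYsub huT haT)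
          (by rw [starSet_empty]; exact empty_subset _) (θ := θ) (G := G)
        rw [starSet_empty] at this
        rw [hY, this, show corrIn G Λ θ T ∅ = 1 from thetaCorr_empty _]
        simp only [hμ, hcY]; ring
      · have : ¬((some u : Option V) ∈ T ∧ (some a : Option V) ∈ T) := fun hcon => hT' (mem_filter.2 ⟨hT, hcon⟩)
        rw [hcYz T hT this]; ring
    have h2 : thetaCorr G Λ θ ({u} ∆ {a}) = (currentPairSum G Λ θ Y ∅ (fun _ => 1)).toReal / (Zg[θ, ∅]).toReal ^ 2 := by
      rw [currentPairSum_one, ENNReal.toReal_mul, thetaCorr_eq_gcurrentZ_div hθ hua', hY, pow_two,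
        mul_div_mul_right _ _ hZpos.ne']
    have h3 : currentPairSum G Λ θ Y ∅ (fun _ => 1) = currentPairSum G Λ θ Y ∅ (fun m => ind Conn[m, some u, some k]) +
        currentPairSum G Λ θ Y ∅ (fun m => ind (¬Conn[m, some u, some k])) := by
      rw [← currentPairSum_add]
      refine currentPairSum_congr fun n₁ n₂ _ _ => ?_
      by_cases h : Conn[n₁ + n₂, some u, some k]
      · rw [ind_of_true h, ind_of_false (not_not.2 h), add_zero]
      · rw [ind_of_false h, ind_of_true h, zero_add]
    rw [h1, h2, h3, ENNReal.toReal_add (currentPairSum_ne_top hθ _ _ fun _ => ind_le_one _)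
      (currentPairSum_ne_top hθ _ _ fun _ => ind_le_one _), add_div, hY]
    ring
  -- (v) the left side as `⟨X⟩⟨Y⟩ - ∑_T μ cX cY`
  have hv : (currentPairSum G Λ θ X Y (fun m => ind Conn[m, some x, some k])).toReal / (Zg[θ, ∅]).toReal ^ 2 =
      thetaCorr G Λ θ ({x} ∆ {u}) * thetaCorr G Λ θ ({u} ∆ {a}) - ∑ T ∈ 𝒯, μ T * (cX T * cY T) := by
    have h3 : currentPairSum G Λ θ X Y (fun _ => 1) = currentPairSum G Λ θ X Y (fun m => ind Conn[m, some x, some k]) +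
        currentPairSum G Λ θ X Y (fun m => ind (¬Conn[m, some x, some k])) := by
      rw [← currentPairSum_add]
      refine currentPairSum_congr fun n₁ n₂ _ _ => ?_
      by_cases h : Conn[n₁ + n₂, some x, some k]
      · rw [ind_of_true h, ind_of_false (not_not.2 h), add_zero]
      · rw [ind_of_false h, ind_of_true h, zero_add]
    rw [← hii, ← hi, h3, ENNReal.toReal_add (currentPairSum_ne_top hθ _ _ fun _ => ind_le_one _)
      (currentPairSum_ne_top hθ _ _ fun _ => ind_le_one _), add_div]
    ring
  -- (vi) the algebra of (5.14)
  rw [hv]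
  set PX := thetaCorr G Λ θ ({x} ∆ {u}) with hPX
  set PY := thetaCorr G Λ θ ({u} ∆ {a}) with hPY
  have hPX0 : 0 ≤ PX := thetaCorr_nonneg hθ hxu'
  have hPY0 : 0 ≤ PY := thetaCorr_nonneg hθ hua'
  have hkey : PX * PY - ∑ T ∈ 𝒯, μ T * (cX T * cY T) ≤
      PY * (PX - ∑ T ∈ 𝒯, μ T * cX T) + PX * (PY - ∑ T ∈ 𝒯, μ T * cY T) := by
    have eL : PX * PY - ∑ T ∈ 𝒯, μ T * (cX T * cY T) = ∑ T ∈ 𝒯, μ T * (PX * PY - cX T * cY T) := by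
      rw [show (∑ T ∈ 𝒯, μ T * (PX * PY - cX T * cY T)) = (∑ T ∈ 𝒯, μ T) * (PX * PY) - ∑ T ∈ 𝒯, μ T * (cX T * cY T) by
        rw [sum_mul, ← sum_sub_distrib]; exact sum_congr rfl fun T _ => by ring, hμ1, one_mul]
    have eR : PY * (PX - ∑ T ∈ 𝒯, μ T * cX T) + PX * (PY - ∑ T ∈ 𝒯, μ T * cY T) =
        ∑ T ∈ 𝒯, μ T * (2 * PX * PY - PY * cX T - PX * cY T) := by
      rw [show (∑ T ∈ 𝒯, μ T * (2 * PX * PY - PY * cX T - PX * cY T)) =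
          (∑ T ∈ 𝒯, μ T) * (2 * PX * PY) - PY * ∑ T ∈ 𝒯, μ T * cX T - PX * ∑ T ∈ 𝒯, μ T * cY T by
        rw [sum_mul, mul_sum, mul_sum, ← sum_sub_distrib, ← sum_sub_distrib]; exact sum_congr rfl fun T _ => by ring, hμ1]
      ring
    rw [eL, eR]
    exact sum_le_sum fun T _ => by
      nlinarith [mul_nonneg (hμ0 T) (mul_nonneg (sub_nonneg.2 (hcXle T)) (sub_nonneg.2 (hcYle T)))]
  refine hkey.trans ?_
  rw [hiii, hiv]
  nlinarith [hPX0, hPY0]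

/-! ## Part C. The cluster-pair weight `R` and its bound -/

/-- **Connections of a vertex separated from the ghost run inside `𝒮_g`**: if `a ∈ 𝒮_g(m)` then
`a ↔ w` in `m` iff `a ↔ w` through charged edges inside `𝒮_g(m)`. [folklore] -/
theorem cconn_iff_cconn_in_clusterCompl {m : Eg → ℕ} {a : V} (ha : (some a : Option V) ∈ 𝒮[m, none]) (w : Option V) :
    Conn[m, some a, w] ↔ CConn Gg Λg m (edgesIn Gg (𝒮[m, none])) (some a) w := by
  refine ⟨fun h => ?_, fun h => h.mono_edges (edgesIn_mono Gg (clusterCompl_subset _ _))⟩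
  have hag : ¬Conn[m, none, some a] := (mem_clusterCompl.1 ha).2
  suffices H : ∀ b, Conn[m, some a, b] → b ∈ 𝒮[m, none] ∧ CConn Gg Λg m (edgesIn Gg (𝒮[m, none])) (some a) b from (H w h).2
  intro b hb
  induction hb with
  | refl => exact ⟨ha, Relation.ReflTransGen.refl⟩
  | tail hab hbc ih =>
    obtain ⟨e, heE, hpos, hes⟩ := hbc
    rename_i b' c
    have hcΛ : c ∈ Λg := (mem_edgesIn_iff.1 heE).2 c (by rw [hes]; exact Sym2.mem_mk_right _ _)
    have hconn_bc : Conn[m, b', c] := Relation.ReflTransGen.single ⟨e, heE, hpos, hes⟩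
    have hc : c ∈ 𝒮[m, none] := by
      refine mem_clusterCompl.2 ⟨hcΛ, fun hgc => hag ?_⟩
      exact (hgc.trans hconn_bc.symm).trans (CConn.symm hab)
    have he_in : (e : Sym2 (Option V)) ∈ edgesIn Gg (𝒮[m, none]) := by
      rw [mem_edgesIn_iff]
      refine ⟨(mem_edgesIn_iff.1 heE).1, fun v hv => ?_⟩
      rw [hes, Sym2.mem_iff] at hv
      rcases hv with rfl | rfl
      · exact ih.1
      · exact hc
    exact ⟨hc, ih.2.tail ⟨e, he_in, hpos, hes⟩⟩

/-- For currents supported inside `T`, connection through all charged edges is connection inside `T`. [folklore] -/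
theorem cconn_iff_of_csupp {n : Eg → ℕ} {T : Finset (Option V)} (hT : T ⊆ Λg) (hs : CSupp Gg Λg (edgesIn Gg T) n)
    (p q : Option V) : Conn[n, p, q] ↔ CConn Gg Λg n (edgesIn Gg T) p q :=
  ⟨fun h => h.of_csupp hs, fun h => h.mono_edges (edgesIn_mono Gg hT)⟩

variable (G Λ) in
/-- **The cluster-pair weight** `R(a,x;u,k) = ∑_{S ∋ g, S ∌ u, k} π_{a,x}(S)`: the weight of the
configurations with sources `{a,x}` in which `a` is separated from the ghost and its cluster
contains `u` and `k` (Aizenman–Fernández 1986, (5.45): `R(0,x,y,u,v,k,l)` with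
`𝟙[{k,l} ∈ C] ≤ 𝟙[0 ↔ k] + 𝟙[0 ↔ l]`). [cite: AizenmanFernandezJSP1986, §5.3, proof of Thm. 5.7 (b), eq. (5.45)] -/
def clusterPairWeight (θ : Sym2 (Option V) → ℝ) (a x u k : V) : ℝ :=
  ∑ S ∈ (Finset.insertNone Λ).powerset.filter (fun S => (none : Option V) ∈ S ∧ (some u : Option V) ∉ S ∧ (some k : Option V) ∉ S),
    clusterWeight G Λ θ a x S

variable (G Λ) in
/-- **The cross-linked cluster expectation** `V(a,u;k,x) = E{⟨σ_aσ_u⟩_{C(h)^c} ⟨σ_xσ_k⟩_{C(h)^c}}`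
(`E` the law of the `h`-cluster, (5.2); the depleted systems are at zero field). [cite: AizenmanFernandezJSP1986, §5.1, Lemma 5.1, eqs. (5.1)–(5.2)] -/
def hclusterPairV (θ : Sym2 (Option V) → ℝ) (a u k x : V) : ℝ :=
  ∑ S' ∈ Λ.powerset, hclusterWeight G Λ θ S' *
    (corrIn G Λ θ (S'.map Function.Embedding.some) ({a} ∆ {u}) * corrIn G Λ θ (S'.map Function.Embedding.some) ({x} ∆ {k}))

/-- `R ≥ 0`. [folklore] -/
theorem clusterPairWeight_nonneg (θ : Sym2 (Option V) → ℝ) (a x u k : V) : 0 ≤ clusterPairWeight G Λ θ a x u k :=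
  sum_nonneg fun S _ => clusterWeight_nonneg θ a x S

/-- `V ≥ 0`. [folklore] -/
theorem hclusterPairV_nonneg {θ : Sym2 (Option V) → ℝ} (hθ : ∀ e, 0 ≤ θ e) {a u k x : V}
    (ha : a ∈ Λ) (hu : u ∈ Λ) (hk : k ∈ Λ) (hx : x ∈ Λ) : 0 ≤ hclusterPairV G Λ θ a u k x :=
  sum_nonneg fun S' _ => mul_nonneg (hclusterWeight_nonneg θ S') (mul_nonneg
    (corrIn_nonneg hθ _ (symmDiff_le_sup.trans (sup_le (singleton_subset_iff.2 ha) (singleton_subset_iff.2 hu))))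
    (corrIn_nonneg hθ _ (symmDiff_le_sup.trans (sup_le (singleton_subset_iff.2 hx) (singleton_subset_iff.2 hk)))))

/-- `R` as a pair sum: `R(a,x;u,k) = Z⁻² ∑_{∂n₁ = ({a}∆{x})*, ∂n₂ = ∅} w w 𝟙[a ↮ g, a ↔ u, a ↔ k]`. [cite: AizenmanFernandezJSP1986, §5.3, eq. (5.45)] -/
theorem clusterPairWeight_eq_pairSum {θ : Sym2 (Option V) → ℝ} (hθ : ∀ e, 0 ≤ θ e) {a x u k : V}
    (hu : u ∈ Λ) (hk : k ∈ Λ) :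
    clusterPairWeight G Λ θ a x u k =
      (currentPairSum G Λ θ (starSet ({a} ∆ {x})) ∅
        (fun m => ind (¬Conn[m, some a, none] ∧ Conn[m, some a, some u] ∧ Conn[m, some a, some k]))).toReal /
        (Zg[θ, ∅]).toReal ^ 2 := by
  unfold clusterPairWeight clusterWeight
  rw [← sum_div, ← ENNReal.toReal_sum (fun S _ => currentPairSum_ne_top hθ _ _ fun _ => ind_le_one _),
    ← currentPairSum_ind_mem_eq_sum]
  congr 2
  refine currentPairSum_congr fun n₁ n₂ _ _ => ind_congr ?_
  rw [mem_filter, mem_powerset, none_mem_clusterCompl_iff, some_mem_clusterCompl_iff hu, some_mem_clusterCompl_iff hk,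
    not_not, not_not]
  exact ⟨fun h => h.2, fun h => ⟨clusterCompl_subset _ _, h⟩⟩

set_option maxHeartbeats 800000 in
/-- **The generic case of the `R` bound** (`x ≠ u`, `u ≠ a`):
`R(a,x;u,k) ≤ ⟨σ_uσ_k⟩_{h=0} [V(a,u;k,x) + V(a,k;u,x)]` — condition on the cluster of the ghost
(Lemma 3.3 with the inside event "`a ↔ u`, `a ↔ k`"), switch `{a,u}` in the depleted zero-field
system, apply Lemma 5.4 there, and `⟨σ_uσ_k⟩_{C(h)^c} ≤ ⟨σ_uσ_k⟩_{h=0}`. [cite: AizenmanFernandezJSP1986, §5.3, proof of Thm. 5.7 (b), eqs. (5.49)–(5.50)] -/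
theorem clusterPairWeight_le_of_ne {θ : Sym2 (Option V) → ℝ} (hθ : ∀ e, 0 ≤ θ e) {a x u k : V}
    (ha : a ∈ Λ) (hx : x ∈ Λ) (hu : u ∈ Λ) (hk : k ∈ Λ) (hxu : x ≠ u) (hua : u ≠ a) :
    clusterPairWeight G Λ θ a x u k ≤
      thetaCorr G Λ (zeroField θ) ({u} ∆ {k}) * (hclusterPairV G Λ θ a u k x + hclusterPairV G Λ θ a k u x) := by
  classical
  have hZpos : 0 < (Zg[θ, ∅]).toReal := toReal_gcurrentZ_ghost_empty_pos subset_rfl hθ subset_rfl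
  set A := starSet ({a} ∆ {x}) with hA
  set ER : (Eg → ℕ) → Prop := fun m => ¬Conn[m, some a, none] ∧ Conn[m, some a, some u] ∧ Conn[m, some a, some k] with hER
  set 𝒰 := Λ.powerset.filter (fun S' => a ∈ S' ∧ x ∈ S' ∧ u ∈ S' ∧ k ∈ S') with h𝒰
  set FS : Finset V → (Eg → ℕ) → ℝ≥0∞ := fun S' m' =>
    ind (CConn Gg Λg m' (edgesIn Gg (S'.map Function.Embedding.some)) (some a) (some u) ∧
      CConn Gg Λg m' (edgesIn Gg (S'.map Function.Embedding.some)) (some a) (some k)) with hFS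
  -- Step 1: `R` as a pair sum and conditioning on the cluster of the ghost with the inside event
  rw [clusterPairWeight_eq_pairSum hθ hu hk, ← hA]
  have hAsub : ∀ {S' : Finset V}, a ∈ S' → x ∈ S' → A ⊆ S'.map Function.Embedding.some := fun {S'} haS hxS =>
    by rw [hA]; exact starSet_pair_subset_map haS hxS
  have hxa_conn : ∀ {n m : Eg → ℕ}, n ≤ m → ∂g n = A → Conn[m, some a, some x] := by
    intro n m hle hsrc
    by_cases hax : a = x
    · rw [hax]; exact Relation.ReflTransGen.refl
    · rw [hA, starSet_pair] at hsrc
      exact (cconn_of_csources_eq (fun h => hax (Option.some_injective _ h)) hsrc).mono fun e => hle e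
  have hdec : currentPairSum G Λ θ A ∅ (fun m => ind (ER m)) =
      ∑ S' ∈ 𝒰, currentPairSum G Λ θ A ∅ (fun m => ind (𝒮[m, none] = S'.map Function.Embedding.some) *
        FS S' (crestr Gg Λg (edgesIn Gg (S'.map Function.Embedding.some)) m)) := by
    rw [← currentPairSum_finset_sum]
    refine currentPairSum_congr fun n₁ n₂ h1 _ => ?_
    set m := n₁ + n₂ with hm
    set T := 𝒮[m, none] with hT
    set S₀ := Finset.eraseNone T with hS₀
    have hTS₀ : T = S₀.map Function.Embedding.some := clusterCompl_none_eq_map m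
    have hS₀Λ : S₀ ⊆ Λ := eraseNone_clusterCompl_subset m none
    have hmemS₀ : ∀ v : V, v ∈ S₀ ↔ (some v : Option V) ∈ T := fun v => by rw [hS₀, Finset.mem_eraseNone]
    -- only `S' = S₀` contributes
    have hother : ∀ S' ∈ 𝒰, S' ≠ S₀ → ind (T = S'.map Function.Embedding.some) *
        FS S' (crestr Gg Λg (edgesIn Gg (S'.map Function.Embedding.some)) m) = 0 := by
      intro S' _ hne
      rw [ind_of_false (fun h => hne ?_), zero_mul]
      rw [hTS₀] at h
      exact (Finset.map_injective _ h).symm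
    -- value of the inside event at `S₀`
    have hF₀ : (some a : Option V) ∈ T → (FS S₀ (crestr Gg Λg (edgesIn Gg T) m) =
        ind (Conn[m, some a, some u] ∧ Conn[m, some a, some k])) := by
      intro haT
      rw [hFS]; simp only
      rw [← hTS₀]
      refine ind_congr ?_
      rw [cconn_crestr_iff, cconn_crestr_iff, ← cconn_iff_cconn_in_clusterCompl haT, ← cconn_iff_cconn_in_clusterCompl haT]
    by_cases hS₀ : S₀ ∈ 𝒰
    · rw [sum_eq_single_of_mem S₀ hS₀ (fun S' hS' hne => hother S' hS' hne), ← hTS₀, ind_of_true rfl, one_mul]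
      have haT : (some a : Option V) ∈ T := (hmemS₀ a).1 (mem_filter.1 hS₀).2.1
      rw [hF₀ haT]
      refine ind_congr ⟨fun h => h.2, fun h => ⟨?_, h⟩⟩
      exact fun hag => (mem_clusterCompl.1 haT).2 hag.symm
    · rw [sum_eq_zero (fun S' hS' => hother S' hS' (fun h => hS₀ (h ▸ hS'))), ind_of_false]
      rintro ⟨hag, hau, hak⟩
      apply hS₀
      have haT : (some a : Option V) ∈ T := mem_clusterCompl.2 ⟨Finset.some_mem_insertNone.2 ha, fun h => hag h.symm⟩
      have hmemT : ∀ {w : V}, w ∈ Λ → Conn[m, some a, some w] → (some w : Option V) ∈ T := fun {w} hw hc =>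
        mem_clusterCompl.2 ⟨Finset.some_mem_insertNone.2 hw, fun h => hag (CConn.symm (h.trans (CConn.symm hc)))⟩
      rw [h𝒰, mem_filter, mem_powerset]
      exact ⟨hS₀Λ, (hmemS₀ a).2 haT, (hmemS₀ x).2 (hmemT hx (hxa_conn (fun e => Nat.le_add_right _ _) h1)),
        (hmemS₀ u).2 (hmemT hu hau), (hmemS₀ k).2 (hmemT hk hak)⟩
  rw [hdec, ENNReal.toReal_sum (fun S' _ => ?_), sum_div]
  swap
  · exact currentPairSum_ne_top hθ A ∅ fun m => by
      calc _ ≤ (1 : ℝ≥0∞) * 1 := mul_le_mul' (ind_le_one _) (ind_le_one _)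
        _ = 1 := one_mul 1
  -- Step 2: for each `S'`, factorise and bound the inside factor by Lemma 5.4 in the depleted system
  have hG0 : 0 ≤ thetaCorr G Λ (zeroField θ) ({u} ∆ {k}) := thetaCorr_nonneg (zeroField_nonneg hθ)
    (symmDiff_le_sup.trans (sup_le (singleton_subset_iff.2 hu) (singleton_subset_iff.2 hk)))
  have hterm : ∀ S' ∈ 𝒰,
      (currentPairSum G Λ θ A ∅ (fun m => ind (𝒮[m, none] = S'.map Function.Embedding.some) *
          FS S' (crestr Gg Λg (edgesIn Gg (S'.map Function.Embedding.some)) m))).toReal / (Zg[θ, ∅]).toReal ^ 2 ≤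
        thetaCorr G Λ (zeroField θ) ({u} ∆ {k}) * (hclusterWeight G Λ θ S' *
          (corrIn G Λ θ (S'.map Function.Embedding.some) ({a} ∆ {u}) * corrIn G Λ θ (S'.map Function.Embedding.some) ({x} ∆ {k}) +
            corrIn G Λ θ (S'.map Function.Embedding.some) ({a} ∆ {k}) * corrIn G Λ θ (S'.map Function.Embedding.some) ({x} ∆ {u}))) := by
    intro S' hS'
    rw [h𝒰, mem_filter, mem_powerset] at hS'
    obtain ⟨hS'Λ, haS, hxS, huS, hkS⟩ := hS'
    obtain ⟨hTΛ, hb⟩ := map_some_subset_and_none (Λ := Λ) hS'Λ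
    set T := S'.map Function.Embedding.some with hTdef
    have hgT : (none : Option V) ∉ T := (mem_sdiff.1 hb).2
    have hAT : A ⊆ T := hAsub haS hxS
    set θT := cplOff θ (Eg \ edgesIn Gg T) with hθT
    have hθT0 : ∀ e, 0 ≤ θT e := cplOff_nonneg hθ _
    have hZT : 0 < (ZIn[θ, T, ∅]).toReal := toReal_gcurrentZ_in_pos hθ hTΛ
    -- the two factorisations
    have e1 := currentPairSum_clusterCompl_eq_inner (G := G) θ hTΛ hb A ∅ (FS S')
    rw [filter_true_of_mem (fun v hv => hAT hv), filter_false_of_mem (fun v hv => not_not.2 (hAT hv))] at e1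
    simp only [Finset.filter_empty] at e1
    have e2 := currentPairSum_clusterCompl_eq (G := G) θ hTΛ hb ∅ ∅
    simp only [Finset.filter_empty] at e2
    set I := innerPairSum G Λ θ T A ∅ (FS S') with hI
    set O := outerSum G Λ θ T none ∅ ∅ with hO
    set CF := currentPairSum G Λ θ A ∅ (fun m => ind (𝒮[m, none] = T) * FS S' (crestr Gg Λg (edgesIn Gg T) m)) with hCF
    set DW := currentPairSum G Λ θ ∅ ∅ (fun m => ind (𝒮[m, none] = T)) with hDW
    -- `CF · Z_T(∅)² = I · DW`
    have e3 : CF * (ZIn[θ, T, ∅] * ZIn[θ, T, ∅]) = I * DW := by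
      rw [e1, e2]; ring
    -- the inside factor is a pair sum of the depleted system
    have hI_eq : I = currentPairSum G Λ θT A ∅ (FS S') := innerPairSum_eq_currentPairSum_cplOff θ T A ∅ (FS S')
    have hIfin : I ≠ ∞ := by rw [hI_eq]; exact currentPairSum_ne_top hθT0 _ _ fun _ => ind_le_one _
    have hDWfin : DW ≠ ∞ := currentPairSum_ne_top hθ _ _ fun _ => ind_le_one _
    have hCFfin : CF ≠ ∞ := currentPairSum_ne_top hθ A ∅ fun m => by
      calc _ ≤ (1 : ℝ≥0∞) * 1 := mul_le_mul' (ind_le_one _) (ind_le_one _)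
        _ = 1 := one_mul 1
    -- real form: `CF/Z² = (I/Z_T²) · hclusterWeight`
    have hreal : CF.toReal / (Zg[θ, ∅]).toReal ^ 2 =
        (I.toReal / (ZIn[θ, T, ∅]).toReal ^ 2) * hclusterWeight G Λ θ S' := by
      have e3' := congrArg ENNReal.toReal e3
      rw [ENNReal.toReal_mul, ENNReal.toReal_mul, ENNReal.toReal_mul] at e3'
      rw [hclusterWeight, show dctW G Λ θ S' = DW from rfl, div_mul_div_comm, div_eq_div_iff (pow_pos hZpos 2).ne' (by positivity)]
      linear_combination e3' * (Zg[θ, ∅]).toReal ^ 2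
    rw [hreal]
    -- the inside bound: switch `{a, u}` in the depleted system and apply Lemma 5.4 there
    have hinner : I.toReal / (ZIn[θ, T, ∅]).toReal ^ 2 ≤
        corrIn G Λ θ T ({u} ∆ {a}) * corrIn G Λ θ T ({u} ∆ {k}) * corrIn G Λ θ T ({x} ∆ {k}) +
          corrIn G Λ θ T ({x} ∆ {u}) * corrIn G Λ θ T ({u} ∆ {k}) * corrIn G Λ θ T ({a} ∆ {k}) := by
      -- replace the inside-`T` connections by plain connections (the currents live in `T`)
      have h1 : currentPairSum G Λ θT A ∅ (FS S') =
          currentPairSum G Λ θT A ∅ (fun m => ind Conn[m, some a, some k] * ind Conn[m, some a, some u]) := by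
        refine currentPairSum_cplOff_congr θ T A ∅ fun n₁ n₂ hs1 hs2 => ?_
        have hs : CSupp Gg Λg (edgesIn Gg T) (n₁ + n₂) := (csupp_add_iff n₁ n₂).2 ⟨hs1, hs2⟩
        rw [hFS]; simp only
        rw [← ind_and]
        refine ind_congr ?_
        rw [← cconn_iff_of_csupp hTΛ hs, ← cconn_iff_of_csupp hTΛ hs]
        exact and_comm
      -- switch `{a, u}`
      have hAY' : A ∆ ({some a} ∆ {some u}) = starSet ({x} ∆ {u}) := by
        rw [hA, starSet_pair, starSet_pair, symmDiff_comm ({some a} : Finset (Option V)) {some x}, symmDiff_assoc,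
          symmDiff_symmDiff_cancel_left]
      have hY' : ({some a} ∆ {some u} : Finset (Option V)) = starSet ({u} ∆ {a}) := by rw [starSet_pair, symmDiff_comm]
      have h2 := (currentPairSum_switching hθT0 A (some a) (some u) (fun m => ind Conn[m, some a, some k])).symm
      rw [hAY', hY'] at h2
      -- in the switched ensemble `a ↔ x`, so `a ↔ k` iff `x ↔ k`
      have h3 : currentPairSum G Λ θT (starSet ({x} ∆ {u})) (starSet ({u} ∆ {a})) (fun m => ind Conn[m, some a, some k]) =
          currentPairSum G Λ θT (starSet ({x} ∆ {u})) (starSet ({u} ∆ {a})) (fun m => ind Conn[m, some x, some k]) := by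
        refine currentPairSum_congr fun n₁ n₂ hs1 hs2 => ind_congr ?_
        rw [starSet_pair] at hs1 hs2
        have hxu'' : Conn[n₁ + n₂, some x, some u] :=
          (cconn_of_csources_eq (fun h => hxu (Option.some_injective _ h)) hs1).mono fun e => Nat.le_add_right _ _
        have hua'' : Conn[n₁ + n₂, some u, some a] :=
          (cconn_of_csources_eq (fun h => hua (Option.some_injective _ h)) hs2).mono fun e => Nat.le_add_left _ _
        have hxa'' : Conn[n₁ + n₂, some x, some a] := hxu''.trans hua''
        exact ⟨fun h => hxa''.trans h, fun h => (CConn.symm hxa'').trans h⟩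
      -- Lemma 5.4 in the depleted system
      have hL := pairSum_two_pairs_conn_le (G := G) (Λ := Λ) hθT0 hx hu ha hk hxu hua (θ := θT)
      have hZeq : gcurrentZ Gg Λg θT Eg ∅ = ZIn[θ, T, ∅] := by
        rw [hθT, gcurrentZ_cplOff, Finset.sdiff_sdiff_eq_self (edgesIn_mono Gg hTΛ)]
      rw [hZeq] at hL
      rw [hI_eq, h1, h2, h3]
      exact hL
    -- Griffiths II: `⟨σ_uσ_k⟩_T ≤ ⟨σ_uσ_k⟩_{h=0}`
    have huk' : ({u} ∆ {k} : Finset V) ⊆ Λ := symmDiff_le_sup.trans (sup_le (singleton_subset_iff.2 hu) (singleton_subset_iff.2 hk))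
    have hGKS : corrIn G Λ θ T ({u} ∆ {k}) ≤ thetaCorr G Λ (zeroField θ) ({u} ∆ {k}) := corrIn_map_le_zeroField hθ S' huk'
    have hc0 : ∀ p q : V, p ∈ Λ → q ∈ Λ → 0 ≤ corrIn G Λ θ T ({p} ∆ {q}) := fun p q hp hq =>
      corrIn_nonneg hθ T (symmDiff_le_sup.trans (sup_le (singleton_subset_iff.2 hp) (singleton_subset_iff.2 hq)))
    have hcw0 := hclusterWeight_nonneg (G := G) (Λ := Λ) θ S'
    have hua_c : corrIn G Λ θ T ({u} ∆ {a}) = corrIn G Λ θ T ({a} ∆ {u}) := by rw [symmDiff_comm]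
    rw [hua_c] at hinner
    have hb1 := mul_nonneg (hc0 a u ha hu) (hc0 x k hx hk)
    have hb2 := mul_nonneg (hc0 x u hx hu) (hc0 a k ha hk)
    calc (I.toReal / (ZIn[θ, T, ∅]).toReal ^ 2) * hclusterWeight G Λ θ S'
        ≤ (corrIn G Λ θ T ({a} ∆ {u}) * corrIn G Λ θ T ({u} ∆ {k}) * corrIn G Λ θ T ({x} ∆ {k}) +
            corrIn G Λ θ T ({x} ∆ {u}) * corrIn G Λ θ T ({u} ∆ {k}) * corrIn G Λ θ T ({a} ∆ {k})) * hclusterWeight G Λ θ S' :=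
          mul_le_mul_of_nonneg_right hinner hcw0
      _ ≤ (thetaCorr G Λ (zeroField θ) ({u} ∆ {k}) * (corrIn G Λ θ T ({a} ∆ {u}) * corrIn G Λ θ T ({x} ∆ {k}) +
            corrIn G Λ θ T ({a} ∆ {k}) * corrIn G Λ θ T ({x} ∆ {u}))) * hclusterWeight G Λ θ S' := by
          refine mul_le_mul_of_nonneg_right ?_ hcw0
          nlinarith [mul_le_mul_of_nonneg_left hGKS hb1, mul_le_mul_of_nonneg_left hGKS hb2]
      _ = _ := by ring
  -- Step 3: sum over the clusters
  refine (sum_le_sum hterm).trans ?_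
  rw [← mul_sum]
  refine mul_le_mul_of_nonneg_left ?_ hG0
  have hsub : 𝒰 ⊆ Λ.powerset := filter_subset _ _
  unfold hclusterPairV
  rw [← sum_add_distrib]
  refine (sum_le_sum_of_subset_of_nonneg hsub fun S' _ _ => ?_).trans (le_of_eq (sum_congr rfl fun S' _ => by ring))
  have hc0 : ∀ p q : V, p ∈ Λ → q ∈ Λ → 0 ≤ corrIn G Λ θ (S'.map Function.Embedding.some) ({p} ∆ {q}) := fun p q hp hq =>
    corrIn_nonneg hθ _ (symmDiff_le_sup.trans (sup_le (singleton_subset_iff.2 hp) (singleton_subset_iff.2 hq)))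
  exact mul_nonneg (hclusterWeight_nonneg θ S') (add_nonneg (mul_nonneg (hc0 a u ha hu) (hc0 x k hx hk))
    (mul_nonneg (hc0 a k ha hk) (hc0 x u hx hu)))

/-- Dropping the condition on `u`: `R(a,x;u,k) ≤ ∑_{S ∋ g, S ∌ k} π_{a,x}(S) = E{⟨σ_aσ_k⟩_{C(h)^c}⟨σ_xσ_k⟩_{C(h)^c}}`. [cite: AizenmanFernandezJSP1986, §5.2, eq. (5.25) (the switched form of `∑ π 𝟙[0 → k]`)] -/
theorem clusterPairWeight_le_sum_hcluster {θ : Sym2 (Option V) → ℝ} (hθ : ∀ e, 0 ≤ θ e) {a x u k : V}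
    (ha : a ∈ Λ) (hx : x ∈ Λ) (hk : k ∈ Λ) :
    clusterPairWeight G Λ θ a x u k ≤
      ∑ S' ∈ Λ.powerset.filter (fun S' => a ∈ S' ∧ k ∈ S' ∧ x ∈ S'),
        hclusterWeight G Λ θ S' * (corrIn G Λ θ (S'.map Function.Embedding.some) ({a} ∆ {k}) *
          corrIn G Λ θ (S'.map Function.Embedding.some) ({x} ∆ {k})) := by
  rw [← sum_clusterWeight_notMem_eq_sum_hcluster hθ ha hx hk]
  unfold clusterPairWeight
  refine sum_le_sum_of_subset_of_nonneg (fun S hS => ?_) fun S _ _ => clusterWeight_nonneg θ a x S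
  rw [mem_filter] at hS ⊢
  exact ⟨hS.1, hS.2.1, hS.2.2.2⟩

/-- **The bound on the cluster-pair weight** (corrected form of Aizenman–Fernández's (5.49)): for all
`a, x, u, k ∈ Λ` and `θ ≥ 0`,
`R(a,x;u,k) ≤ ⟨σ_uσ_k⟩_{h=0} · [V(a,u;k,x) + V(a,k;u,x)]`,
`V(a,u;k,x) = E{⟨σ_aσ_u⟩_{C(h)^c}⟨σ_xσ_k⟩_{C(h)^c}}` (the generic case `clusterPairWeight_le_of_ne`; the
coincidences `u = a`, `u = x` directly from `R ≤ E{⟨σ_aσ_k⟩⟨σ_xσ_k⟩}` and Griffiths II). Summed over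
`x` and averaged over the base point `a`, `∑ V` becomes `E{χ_{C^c}(u) χ_{C^c}(k)}`, which is how the
printed `⟨σ_0σ_k⟩_{h=0} T(0,u,x)` of (5.49)–(5.51) is recovered. [cite: AizenmanFernandezJSP1986, §5.3, proof of Thm. 5.7 (b), eqs. (5.49)–(5.51)] -/
theorem clusterPairWeight_le {θ : Sym2 (Option V) → ℝ} (hθ : ∀ e, 0 ≤ θ e) {a x u k : V}
    (ha : a ∈ Λ) (hx : x ∈ Λ) (hu : u ∈ Λ) (hk : k ∈ Λ) :
    clusterPairWeight G Λ θ a x u k ≤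
      thetaCorr G Λ (zeroField θ) ({u} ∆ {k}) * (hclusterPairV G Λ θ a u k x + hclusterPairV G Λ θ a k u x) := by
  have hc0 : ∀ (S' : Finset V) (p q : V), p ∈ Λ → q ∈ Λ → 0 ≤ corrIn G Λ θ (S'.map Function.Embedding.some) ({p} ∆ {q}) :=
    fun S' p q hp hq => corrIn_nonneg hθ _ (symmDiff_le_sup.trans (sup_le (singleton_subset_iff.2 hp) (singleton_subset_iff.2 hq)))
  have hc1 : ∀ (S' : Finset V) (p : V), corrIn G Λ θ (S'.map Function.Embedding.some) ({p} ∆ {p}) = 1 := fun S' p => by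
    rw [symmDiff_self, Finset.bot_eq_empty]; exact thetaCorr_empty _
  have hV0 : ∀ {p q r t : V}, p ∈ Λ → q ∈ Λ → r ∈ Λ → t ∈ Λ → 0 ≤ hclusterPairV G Λ θ p q r t :=
    fun hp hq hr ht => hclusterPairV_nonneg hθ hp hq hr ht
  by_cases hua : u = a
  · subst hua
    have hG0 : 0 ≤ thetaCorr G Λ (zeroField θ) ({u} ∆ {k}) := thetaCorr_nonneg (zeroField_nonneg hθ)
      (symmDiff_le_sup.trans (sup_le (singleton_subset_iff.2 hu) (singleton_subset_iff.2 hk)))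
    have hGKS : ∀ S' : Finset V, corrIn G Λ θ (S'.map Function.Embedding.some) ({u} ∆ {k}) ≤ thetaCorr G Λ (zeroField θ) ({u} ∆ {k}) :=
      fun S' => corrIn_map_le_zeroField hθ S' (symmDiff_le_sup.trans (sup_le (singleton_subset_iff.2 hu) (singleton_subset_iff.2 hk)))
    refine (clusterPairWeight_le_sum_hcluster hθ hu hx hk).trans ?_
    have h1 : ∑ S' ∈ Λ.powerset.filter (fun S' => u ∈ S' ∧ k ∈ S' ∧ x ∈ S'),
        hclusterWeight G Λ θ S' * (corrIn G Λ θ (S'.map Function.Embedding.some) ({u} ∆ {k}) *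
          corrIn G Λ θ (S'.map Function.Embedding.some) ({x} ∆ {k})) ≤
        thetaCorr G Λ (zeroField θ) ({u} ∆ {k}) * hclusterPairV G Λ θ u u k x := by
      unfold hclusterPairV
      rw [mul_sum]
      refine (sum_le_sum_of_subset_of_nonneg (filter_subset _ _) fun S' _ _ =>
        mul_nonneg (hclusterWeight_nonneg θ S') (mul_nonneg (hc0 S' u k hu hk) (hc0 S' x k hx hk))).trans ?_
      refine sum_le_sum fun S' _ => ?_
      rw [hc1 S' u, one_mul]
      have := hGKS S'
      have h0 := hclusterWeight_nonneg (G := G) (Λ := Λ) θ S'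
      nlinarith [mul_le_mul_of_nonneg_left this (mul_nonneg h0 (hc0 S' x k hx hk))]
    nlinarith [h1, mul_nonneg hG0 (hV0 hu hk hu hx)]
  by_cases hxu : x = u
  · subst hxu
    have hG0 : 0 ≤ thetaCorr G Λ (zeroField θ) ({x} ∆ {k}) := thetaCorr_nonneg (zeroField_nonneg hθ)
      (symmDiff_le_sup.trans (sup_le (singleton_subset_iff.2 hx) (singleton_subset_iff.2 hk)))
    have hGKS : ∀ S' : Finset V, corrIn G Λ θ (S'.map Function.Embedding.some) ({x} ∆ {k}) ≤ thetaCorr G Λ (zeroField θ) ({x} ∆ {k}) :=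
      fun S' => corrIn_map_le_zeroField hθ S' (symmDiff_le_sup.trans (sup_le (singleton_subset_iff.2 hx) (singleton_subset_iff.2 hk)))
    refine (clusterPairWeight_le_sum_hcluster hθ ha hx hk).trans ?_
    have h1 : ∑ S' ∈ Λ.powerset.filter (fun S' => a ∈ S' ∧ k ∈ S' ∧ x ∈ S'),
        hclusterWeight G Λ θ S' * (corrIn G Λ θ (S'.map Function.Embedding.some) ({a} ∆ {k}) *
          corrIn G Λ θ (S'.map Function.Embedding.some) ({x} ∆ {k})) ≤
        thetaCorr G Λ (zeroField θ) ({x} ∆ {k}) * hclusterPairV G Λ θ a k x x := by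
      unfold hclusterPairV
      rw [mul_sum]
      refine (sum_le_sum_of_subset_of_nonneg (filter_subset _ _) fun S' _ _ =>
        mul_nonneg (hclusterWeight_nonneg θ S') (mul_nonneg (hc0 S' a k ha hk) (hc0 S' x k hx hk))).trans ?_
      refine sum_le_sum fun S' _ => ?_
      rw [hc1 S' x, mul_one]
      have := hGKS S'
      have h0 := hclusterWeight_nonneg (G := G) (Λ := Λ) θ S'
      nlinarith [mul_le_mul_of_nonneg_left this (mul_nonneg h0 (hc0 S' a k ha hk))]
    nlinarith [h1, mul_nonneg hG0 (hV0 ha hx hk hx)]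
  exact clusterPairWeight_le_of_ne hθ ha hx hu hk hxu (fun h => hua h)

end SecondOrder

end Literature.Probability.LatticeModels
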